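import Summits.Ventures.CertifiedQuantumChemistry.Rows.HubbardRingTVAtomicLimit
import Mathlib.Topology.Order.MonotoneConvergence
import HarnessLib

/-!
# Ventures/CertifiedQuantumChemistry — Rows/HubbardRingTVStrongCouplingLimitExists.lean: the STRONG-COUPLING
# LIMITS `U → ∞` of the exact sector energy AND of the level-DQG value EXIST in every sector of every TV-H
# ring at most half filled (monotone and bounded), with `OPT_∞ ≤ E₀_∞ ≤ 0`; at half filling both are `0`

HONEST FRAMING (verbatim): certified bounds for a stated model Hamiltonian in a stated basis; not a
claim about the real molecule beyond that model.

Seat rdm-B, ROWS courtesy file (theorems only; no `def`, no notation, no instance; zero compute). The words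
of `HOME/STRUCTURE.md` §2 speak of the `U → ∞` values of the programmes ("plateau", `X_∞`); S-U itself is about
the SCALED gap `(U/4)(E₀ − OPT_X)` at half filling. This file types the unscaled, elementary half of the
picture in EVERY sector `a + b ≤ L` (for `a + b > L` subtract the forced doublon energy `U·(a + b − L)` and
use particle–hole, gen 38 — not done here):

* §1 (every `t, U`, any graph) `hamiltonian_zero_apply_self` (the hopping Hamiltonian has ZERO DIAGONAL in
  the occupation basis), `hamiltonian_apply_self` (`H_G(t, U)_{ss} = U·#(doubly occupied sites of s)`),
  **`hubbardRingTV_energy_le_card_inter`** (`E₀(L; t, U; |α|, |β|) ≤ U·|α ∩ β|` — the determinant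
  `|α↑ ∪ β↓⟩`'s Rayleigh quotient, for EVERY `t`; gen 40's atomic file had `t = 0`), hence
  `hubbardRingTV_energy_le_mul_sub` (`E₀ ≤ U·(a + b − L)₊`), `hubbardRingTV_energy_le_mul_min`
  (`E₀ ≤ U·min(a, b)`), **`hubbardRingTV_energy_nonpos`** (`a + b ≤ L` ⇒ `E₀(L; t, U; a, b) ≤ 0` for every
  `t, U` — gen 35 had `a + b = L`), `hubbardRingTV_pqgSectorEnergy_nonpos`.
* §2 (`a + b ≤ L`, every `t`) **`hubbardRingTV_energy_tendsto_iSup`**,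
  **`hubbardRingTV_pqgSectorEnergy_tendsto_iSup`** — `U ↦ E₀(L; t, U; a, b)` and `U ↦ OPT_DQG(L; t, U; a, b)`
  are non-decreasing (gen 36 / gen 38) and `≤ 0`, so they CONVERGE along rational `U → ∞` to their suprema
  `E₀_∞ := ⨆_U E₀(U)`, `OPT_∞ := ⨆_U OPT_DQG(U)` (written as `iSup`s — no definition is introduced);
  `hubbardRingTV_iSup_pqgSectorEnergy_le_iSup_energy`, `hubbardRingTV_iSup_energy_nonpos`
  (`OPT_∞ ≤ E₀_∞ ≤ 0`), `hubbardRingTV_energy_le_iSup` / `…pqgSectorEnergy_le_iSup` (every finite-`U` value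
  is below its limit), **`hubbardRingTV_gap_tendsto`** (the certified gap converges to `E₀_∞ − OPT_∞ ≥ 0`).
* §3 (half filling `a + b = L ≥ 2`, every `t`) **`hubbardRingTV_pqgSectorEnergy_tendsto_zero_halfFilled`**,
  **`hubbardRingTV_energy_tendsto_zero_halfFilled`** (`OPT_DQG, E₀ → 0`: squeezed between gen 36's
  `−4t²L³/U` and `0`), `hubbardRingTV_iSup_eq_zero_halfFilled` (both suprema `= 0`),
  `hubbardRingTV_gap_tendsto_zero_halfFilled` (the UNSCALED gap vanishes in the limit — S-U's scaled gap is
  the next order and is NOT touched).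

READING: existence statements for limits of VALUES of the abstract programme and of the exact sector
energies of the cell's own model object; no rate, no scaled statement, no certificate, row or value of
record; S-U UNTOUCHED. All PROVED (0 sorry, standard axioms); no defs, no named facts. References
(docstring-only): E. H. Lieb, PRL 62 (1989) 1201; D. A. Mazziotti, Adv. Chem. Phys. 134 (2007) ch. 3 §II.F.
Tree (REUSED): `hubbardRingTV_energy_mono` (gen 38), `StrongCouplingDoublon.hubbardRingTV_pqgSectorEnergy_mono`
(gen 36), `StrongCouplingGap.hubbardRingTV_pqgSectorEnergy_ge` (gen 36), `AtomicLimit.exists_card_inter_eq_sub`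
/ `…_eq_min` (gen 40), `exists_adj_of_hamiltonian_zero_apply_ne_zero`, `hamiltonian_eq_add_smul_diagonal`
(typer), `LiebTwo.creation_mul_annihilation_apply_ne_zero`, `hubbardRingTV_hamiltonian_eq`,
`isInSector_single_pairSet`, `sectorGroundEnergy_le_of_rayleigh`, `pqgSectorEnergy_le_sectorGroundEnergy`
(Literature). Mathlib: `tendsto_atTop_ciSup`, `le_ciSup`, `ciSup_le`, `tendsto_nhds_unique`,
`tendsto_of_tendsto_of_tendsto_of_le_of_le'`, `tendsto_ratCast_atTop_iff`.
-/

noncomputable section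

namespace Summit.Ventures.CertifiedQuantumChemistry

open Matrix Finset Filter Topology Literature.MathematicalPhysics.QuantumLattice
open Literature.MathematicalPhysics.QuantumChemistry Summit.Ventures.CertifiedQuantumChemistry.Hamiltonians
open scoped ComplexOrder

/-! ## §1 Determinant Rayleigh quotients: `E₀(L; t, U; |α|, |β|) ≤ U·|α ∩ β|` for every `t` -/

section Determinant

/-- **The hopping Hamiltonian has zero diagonal in the occupation basis** (any finite simple graph, any
`t`): a hopping term `c†_{xσ} c_{yσ}` along an edge moves an electron, `x ≠ y`. [folklore] -/
theorem hamiltonian_zero_apply_self {Λ : Type*} [LinearOrder Λ] [Fintype Λ] (G : SimpleGraph Λ)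
    [DecidableRel G.Adj] (t : ℝ) (s : Finset (Orb Λ)) : hamiltonian G t 0 s s = 0 := by
  by_contra h
  obtain ⟨x, y, σ, hadj, hne⟩ := exists_adj_of_hamiltonian_zero_apply_ne_zero G t h
  obtain ⟨hx, -, hs⟩ := LiebTwo.creation_mul_annihilation_apply_ne_zero hne
  rw [hs] at hx
  rcases Finset.mem_insert.1 hx with hxy | hxe
  · exact G.ne_of_adj hadj (orb_inj.1 hxy).1
  · exact Finset.notMem_erase _ _ hxe

/-- **The diagonal of the graph Hubbard Hamiltonian**: `H_G(t, U)_{ss} = U·#(doubly occupied sites of s)`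
for every `t, U` and every configuration `s`. [folklore] -/
theorem hamiltonian_apply_self {Λ : Type*} [LinearOrder Λ] [Fintype Λ] (G : SimpleGraph Λ)
    [DecidableRel G.Adj] (t U : ℝ) (s : Finset (Orb Λ)) :
    hamiltonian G t U s s = (U : ℂ) * ((((doublyOccupied s).card : ℕ) : ℝ) : ℂ) := by
  rw [hamiltonian_eq_add_smul_diagonal G t U, Matrix.add_apply, hamiltonian_zero_apply_self, zero_add,
    Matrix.smul_apply, Matrix.diagonal_apply_eq, smul_eq_mul]

variable {L : ℕ} (t U : ℚ)

/-- **`E₀(L; t, U; |α|, |β|) ≤ U·|α ∩ β|`** for all `α, β ⊆ Fin L` and EVERY `t, U`: the Rayleigh quotient of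
the occupation-basis vector `|α↑ ∪ β↓⟩` is the diagonal entry `U·|α ∩ β|` (the hopping part has zero
diagonal). [folklore] -/
theorem hubbardRingTV_energy_le_card_inter (α β : Finset (Fin L)) :
    Model.energy (hubbardRingTV L t U) α.card β.card ≤ (U : ℝ) * ((α ∩ β).card : ℝ) := by
  classical
  have hsec : IsInSector α.card β.card (Pi.single (pairSet α β) (1 : ℂ) : Fock (Orb (Fin L))) :=
    isInSector_single_pairSet α β
  have hne : (Pi.single (pairSet α β) (1 : ℂ) : Fock (Orb (Fin L))) ≠ 0 := by
    intro h0
    have h1 := congrFun h0 (pairSet α β)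
    simp at h1
  unfold Model.energy
  refine sectorGroundEnergy_le_of_rayleigh (hubbardRingTV_hamiltonian_isHermitian L t U) hsec hne ?_
  have hdiag : (hubbardRingTV L t U).hamiltonian (pairSet α β) (pairSet α β) =
      (((U : ℝ) : ℝ) : ℂ) * ((((α ∩ β).card : ℕ) : ℝ) : ℂ) := by
    rw [hubbardRingTV_hamiltonian_eq, hamiltonian_apply_self, doublyOccupied, upPart_pairSet, downPart_pairSet]
  have hq : star (Pi.single (pairSet α β) (1 : ℂ) : Fock (Orb (Fin L))) ⬝ᵥ
      (hubbardRingTV L t U).hamiltonian *ᵥ Pi.single (pairSet α β) 1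
      = (hubbardRingTV L t U).hamiltonian (pairSet α β) (pairSet α β) := by
    rw [← Pi.single_star, star_one, Matrix.mulVec_single_one, single_dotProduct, one_mul, Matrix.col_apply]
  have hn : star (Pi.single (pairSet α β) (1 : ℂ) : Fock (Orb (Fin L))) ⬝ᵥ Pi.single (pairSet α β) 1 = 1 := by
    rw [← Pi.single_star, star_one, single_dotProduct, one_mul, Pi.single_eq_same]
  rw [hq, hdiag, hn, Complex.one_re, mul_one, ← Complex.ofReal_mul, Complex.ofReal_re]

/-- **`E₀(L; t, U; a, b) ≤ U·(a + b − L)₊`** for every `t, U` and `a, b ≤ L` (a determinant with the fewest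
doubly occupied sites). [folklore] -/
theorem hubbardRingTV_energy_le_mul_sub {a b : ℕ} (ha : a ≤ L) (hb : b ≤ L) :
    Model.energy (hubbardRingTV L t U) a b ≤ (U : ℝ) * ((a + b - L : ℕ) : ℝ) := by
  obtain ⟨α, β, hα, hβ, hαβ⟩ := AtomicLimit.exists_card_inter_eq_sub ha hb
  have h := hubbardRingTV_energy_le_card_inter t U α β
  rwa [hα, hβ, hαβ] at h

/-- **`E₀(L; t, U; a, b) ≤ U·min(a, b)`** for every `t, U` and `a, b ≤ L` (a determinant with the most doubly
occupied sites; the better bound of the two for `U < 0`). [folklore] -/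
theorem hubbardRingTV_energy_le_mul_min {a b : ℕ} (ha : a ≤ L) (hb : b ≤ L) :
    Model.energy (hubbardRingTV L t U) a b ≤ (U : ℝ) * ((min a b : ℕ) : ℝ) := by
  obtain ⟨α, β, hα, hβ, hαβ⟩ := AtomicLimit.exists_card_inter_eq_min ha hb
  have h := hubbardRingTV_energy_le_card_inter t U α β
  rwa [hα, hβ, hαβ] at h

/-- **`E₀(L; t, U; a, b) ≤ 0` IN EVERY SECTOR AT MOST HALF FILLED** (`a + b ≤ L`; every `t`, every `U`): a
determinant without doubly occupied sites exists. (Gen 35's `hubbardRingTV_sectorGroundEnergy_le_zero` is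
the case `a + b = L`.) [folklore] -/
theorem hubbardRingTV_energy_nonpos {a b : ℕ} (hN : a + b ≤ L) : Model.energy (hubbardRingTV L t U) a b ≤ 0 := by
  have h := hubbardRingTV_energy_le_mul_sub (L := L) t U (a := a) (b := b) (by omega) (by omega)
  rwa [Nat.sub_eq_zero_of_le hN, Nat.cast_zero, mul_zero] at h

/-- **`OPT_DQG(L; t, U; a, b) ≤ 0`** in every sector at most half filled (below `E₀ ≤ 0`). [folklore] -/
theorem hubbardRingTV_pqgSectorEnergy_nonpos {a b : ℕ} (hN : a + b ≤ L) :
    Model.pqgSectorEnergy (hubbardRingTV L t U) a b ≤ 0 :=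
  (pqgSectorEnergy_le_sectorGroundEnergy (hubbardRingTV_hamiltonian_isHermitian L t U)
    (by rw [Fintype.card_fin]; omega) (by rw [Fintype.card_fin]; omega)).trans (hubbardRingTV_energy_nonpos t U hN)

end Determinant

/-! ## §2 Monotone and bounded: the strong-coupling limits exist in every sector at most half filled -/

section Limits

variable {L : ℕ} (t : ℚ)

/-- **THE STRONG-COUPLING LIMIT OF THE EXACT SECTOR ENERGY EXISTS** (`a + b ≤ L`, every `t`):
`E₀(L; t, U; a, b) → ⨆_U E₀(L; t, U; a, b)` along rational `U → ∞` (non-decreasing in `U`, bounded by `0`).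
[folklore] -/
theorem hubbardRingTV_energy_tendsto_iSup {a b : ℕ} (hN : a + b ≤ L) :
    Tendsto (fun U : ℚ => Model.energy (hubbardRingTV L t U) a b) atTop
      (𝓝 (⨆ U : ℚ, Model.energy (hubbardRingTV L t U) a b)) := by
  refine tendsto_atTop_ciSup (fun U U' h => hubbardRingTV_energy_mono t h (by omega) (by omega)) ⟨0, ?_⟩
  rintro _ ⟨U, rfl⟩
  exact hubbardRingTV_energy_nonpos t U hN

/-- **THE STRONG-COUPLING LIMIT OF THE LEVEL-DQG VALUE EXISTS** (`a + b ≤ L`, every `t`):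
`OPT_DQG(L; t, U; a, b) → ⨆_U OPT_DQG(L; t, U; a, b)` along rational `U → ∞`. [folklore] -/
theorem hubbardRingTV_pqgSectorEnergy_tendsto_iSup {a b : ℕ} (hN : a + b ≤ L) :
    Tendsto (fun U : ℚ => Model.pqgSectorEnergy (hubbardRingTV L t U) a b) atTop
      (𝓝 (⨆ U : ℚ, Model.pqgSectorEnergy (hubbardRingTV L t U) a b)) := by
  refine tendsto_atTop_ciSup
    (fun U U' h => StrongCouplingDoublon.hubbardRingTV_pqgSectorEnergy_mono t h (by omega) (by omega)) ⟨0, ?_⟩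
  rintro _ ⟨U, rfl⟩
  exact hubbardRingTV_pqgSectorEnergy_nonpos t U hN

/-- Every finite-`U` exact energy is below the limit: `E₀(L; t, U; a, b) ≤ ⨆_{U′} E₀(L; t, U′; a, b)`
(`a + b ≤ L`). [folklore] -/
theorem hubbardRingTV_energy_le_iSup {a b : ℕ} (hN : a + b ≤ L) (U : ℚ) :
    Model.energy (hubbardRingTV L t U) a b ≤ ⨆ U' : ℚ, Model.energy (hubbardRingTV L t U') a b :=
  le_ciSup (f := fun U' : ℚ => Model.energy (hubbardRingTV L t U') a b)
    ⟨0, by rintro _ ⟨U', rfl⟩; exact hubbardRingTV_energy_nonpos t U' hN⟩ U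

/-- Every finite-`U` level-DQG value is below the limit: `OPT_DQG(L; t, U; a, b) ≤ ⨆_{U′} OPT_DQG(L; t, U′; a, b)`
(`a + b ≤ L`). [folklore] -/
theorem hubbardRingTV_pqgSectorEnergy_le_iSup {a b : ℕ} (hN : a + b ≤ L) (U : ℚ) :
    Model.pqgSectorEnergy (hubbardRingTV L t U) a b ≤ ⨆ U' : ℚ, Model.pqgSectorEnergy (hubbardRingTV L t U') a b :=
  le_ciSup (f := fun U' : ℚ => Model.pqgSectorEnergy (hubbardRingTV L t U') a b)
    ⟨0, by rintro _ ⟨U', rfl⟩; exact hubbardRingTV_pqgSectorEnergy_nonpos t U' hN⟩ U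

/-- **`E₀_∞ ≤ 0`**: the strong-coupling limit of the exact energy is non-positive (`a + b ≤ L`). [folklore] -/
theorem hubbardRingTV_iSup_energy_nonpos {a b : ℕ} (hN : a + b ≤ L) :
    (⨆ U : ℚ, Model.energy (hubbardRingTV L t U) a b) ≤ 0 :=
  ciSup_le fun U => hubbardRingTV_energy_nonpos t U hN

/-- **`OPT_∞ ≤ E₀_∞`**: the limit of the relaxation values is below the limit of the exact energies
(`a + b ≤ L`). [folklore] -/
theorem hubbardRingTV_iSup_pqgSectorEnergy_le_iSup_energy {a b : ℕ} (hN : a + b ≤ L) :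
    (⨆ U : ℚ, Model.pqgSectorEnergy (hubbardRingTV L t U) a b) ≤ ⨆ U : ℚ, Model.energy (hubbardRingTV L t U) a b :=
  ciSup_le fun U => (pqgSectorEnergy_le_sectorGroundEnergy (hubbardRingTV_hamiltonian_isHermitian L t U)
    (by rw [Fintype.card_fin]; omega) (by rw [Fintype.card_fin]; omega)).trans (hubbardRingTV_energy_le_iSup t hN U)

/-- **THE CERTIFIED GAP CONVERGES AT STRONG COUPLING** (`a + b ≤ L`, every `t`):
`E₀(L; t, U; a, b) − OPT_DQG(L; t, U; a, b) → E₀_∞ − OPT_∞ ≥ 0` along rational `U → ∞`. [folklore] -/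
theorem hubbardRingTV_gap_tendsto {a b : ℕ} (hN : a + b ≤ L) :
    Tendsto (fun U : ℚ => Model.energy (hubbardRingTV L t U) a b - Model.pqgSectorEnergy (hubbardRingTV L t U) a b)
      atTop (𝓝 ((⨆ U : ℚ, Model.energy (hubbardRingTV L t U) a b) -
        ⨆ U : ℚ, Model.pqgSectorEnergy (hubbardRingTV L t U) a b)) ∧
    0 ≤ (⨆ U : ℚ, Model.energy (hubbardRingTV L t U) a b) - ⨆ U : ℚ, Model.pqgSectorEnergy (hubbardRingTV L t U) a b :=
  ⟨(hubbardRingTV_energy_tendsto_iSup t hN).sub (hubbardRingTV_pqgSectorEnergy_tendsto_iSup t hN),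
    sub_nonneg.2 (hubbardRingTV_iSup_pqgSectorEnergy_le_iSup_energy t hN)⟩

end Limits

/-! ## §3 Half filling: both limits vanish -/

section HalfFilled

variable {L : ℕ} (t : ℚ)

/-- **AT HALF FILLING THE LEVEL-DQG VALUE TENDS TO `0`** (`a + b = L ≥ 2`, every `t`): squeezed between
gen 36's `−4t²L³/U` (for `U > 0`) and `0`. [folklore] -/
theorem hubbardRingTV_pqgSectorEnergy_tendsto_zero_halfFilled (hL : 2 ≤ L) {a b : ℕ} (hN : a + b = L) :
    Tendsto (fun U : ℚ => Model.pqgSectorEnergy (hubbardRingTV L t U) a b) atTop (𝓝 0) := by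
  have hlow : Tendsto (fun U : ℚ => -(4 * (t : ℝ) ^ 2 * (L : ℝ) ^ 3 / U)) atTop (𝓝 0) := by
    have h := (tendsto_const_nhds (x := 4 * (t : ℝ) ^ 2 * (L : ℝ) ^ 3)).div_atTop
      (tendsto_ratCast_atTop_iff.2 tendsto_id)
    simpa using h.neg
  refine tendsto_of_tendsto_of_tendsto_of_le_of_le' hlow tendsto_const_nhds ?_ ?_
  · filter_upwards [eventually_gt_atTop (0 : ℚ)] with U hU
    exact StrongCouplingGap.hubbardRingTV_pqgSectorEnergy_ge hL t hU hN
  · exact Eventually.of_forall fun U => hubbardRingTV_pqgSectorEnergy_nonpos t U hN.le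

/-- **AT HALF FILLING THE EXACT SECTOR ENERGY TENDS TO `0`** (`a + b = L ≥ 2`, every `t`): squeezed between
`OPT_DQG → 0` and `0`. [folklore] -/
theorem hubbardRingTV_energy_tendsto_zero_halfFilled (hL : 2 ≤ L) {a b : ℕ} (hN : a + b = L) :
    Tendsto (fun U : ℚ => Model.energy (hubbardRingTV L t U) a b) atTop (𝓝 0) :=
  tendsto_of_tendsto_of_tendsto_of_le_of_le (hubbardRingTV_pqgSectorEnergy_tendsto_zero_halfFilled t hL hN)
    tendsto_const_nhds
    (fun U => pqgSectorEnergy_le_sectorGroundEnergy (hubbardRingTV_hamiltonian_isHermitian L t U)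
      (by rw [Fintype.card_fin]; omega) (by rw [Fintype.card_fin]; omega))
    (fun U => hubbardRingTV_energy_nonpos t U hN.le)

/-- **AT HALF FILLING BOTH SUPREMA VANISH**: `⨆_U OPT_DQG(L; t, U; a, b) = 0` and `⨆_U E₀(L; t, U; a, b) = 0`
(`a + b = L ≥ 2`, every `t`). [folklore] -/
theorem hubbardRingTV_iSup_eq_zero_halfFilled (hL : 2 ≤ L) {a b : ℕ} (hN : a + b = L) :
    (⨆ U : ℚ, Model.pqgSectorEnergy (hubbardRingTV L t U) a b) = 0 ∧
      (⨆ U : ℚ, Model.energy (hubbardRingTV L t U) a b) = 0 :=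
  ⟨tendsto_nhds_unique (hubbardRingTV_pqgSectorEnergy_tendsto_iSup t hN.le)
      (hubbardRingTV_pqgSectorEnergy_tendsto_zero_halfFilled t hL hN),
    tendsto_nhds_unique (hubbardRingTV_energy_tendsto_iSup t hN.le)
      (hubbardRingTV_energy_tendsto_zero_halfFilled t hL hN)⟩

/-- **AT HALF FILLING THE UNSCALED CERTIFIED GAP VANISHES IN THE LIMIT**: `E₀ − OPT_DQG → 0` along
`U → ∞` (`a + b = L ≥ 2`, every `t`) — S-U's SCALED gap `(U/4)(E₀ − OPT)` is the next order and is not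
touched here. [folklore] -/
theorem hubbardRingTV_gap_tendsto_zero_halfFilled (hL : 2 ≤ L) {a b : ℕ} (hN : a + b = L) :
    Tendsto (fun U : ℚ => Model.energy (hubbardRingTV L t U) a b - Model.pqgSectorEnergy (hubbardRingTV L t U) a b)
      atTop (𝓝 0) := by
  have h := (hubbardRingTV_energy_tendsto_zero_halfFilled t hL hN).sub
    (hubbardRingTV_pqgSectorEnergy_tendsto_zero_halfFilled t hL hN)
  rwa [sub_zero] at h

end HalfFilled

end Summit.Ventures.CertifiedQuantumChemistry

end
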